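import Summits.ABC.IUTFork.Joshi.InitialThetaDataJoshi
import Summits.ABC.IUTFork.Joshi.ATS3FundamentalEstimate
import HarnessLib

/-!
# [J-III] Thm 9.11.1 / Cor 9.11.1.1 WITH THEIR PRINTED HYPOTHESIS LIST — the O-046 wrapper over E-t6's `ATS3.InitialThetaData`

Record file of the abc-iut cell, branch E (rung LADDER-ABC:A2.E; seat abc-iut-E-t4; OBJECTS.tsv O-046 «THE FUNDAMENTAL ESTIMATE (hypothesis
list VERBATIM as a structure) and Cor 9.11.1.1»; ASSIGNMENTS open item «E-t6 ↔ E-t4: field names of the E4h hypothesis structure (J3 §2.4/§3.1/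
§3.3) — one structure, typed once (T-06 file), imported by E-t4», now discharged). **No side is taken** on [IUTchIII] Cor. 3.12 or on any
author; unrefereed preprint; typed ≠ proved ≠ endorsed. Object file (E-PLAN R14): imports only the two landed Joshi object files.

[J-III] arXiv:2401.13508v4 Thm 9.11.1, p.127 l.8–22: «For X, C, L, L′ satisfying §2.4, §3.1, §3.3, and for an odd prime ℓ ≫ 0 one has
Vol(Θ̃^𝓘_Mochizuki) ≥ ∏_{w ∈ 𝕍^{odd,ss}} |q_w^{1/2ℓ}|^{ℓ*}, and also Vol(Θ̃^𝓘_Joshi) ≥ ∏_{w ∈ 𝕍^{odd,ss}} |q_w^{1/2ℓ}|^{ℓ*}.» Cor 9.11.1.1, p.128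
l.42–52: «With notations and assumptions of Theorem 9.11.1, and in Mochizuki's notational conventions …».
THE HYPOTHESIS LIST, as typed by abc-iut-E-t6 (`Joshi/InitialThetaDataJoshi.lean`, `ATS3.InitialThetaData L L' Lbar C ℓ`: §3.1 (1)–(4)
p.27 l.11–19 + §3.3 (9)–(14) p.28 l.1–12, one field per printed clause; §2.4's «Strict Belyi Type» NOT CARRIED there — E-t6's flag) together
with: the finite set `W ⊆ 𝕍^{odd,ss}` of places the product runs over (E-t6's `InitialThetaData.Voddss`; finiteness: [J-III] Thm 7.3.1 proof
p.55 l.13–16), `ℓ* := D.lstar = (ℓ − 1)/2` ((11) p.28 l.5–6), and the locus datum at those places (`ATS3.AdelicLocusDatum`, p428048). The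
printed «odd prime ℓ ≫ 0» is (11)'s `ℓ ≥ 5` prime here; the typed spine (p428048) needs no largeness (termwise `j²/ℓ*² ≤ 1`).
CONTENT: `Thm9111` / `Cor91111` = the printed statements as `Prop`s over (hypothesis structure, `W`, datum); `thm9111_of_inputs` /
`cor91111_of_inputs` = p428048's proved spine re-exported under the printed hypothesis list (inputs BY NAME: (9.9.4) `ValuationScaling`,
Lemma 9.10.7.1 at the exhibited element `HullVolumeLowerBound`, sign convention `LogVolNonpos`). [claim: Joshi2024ATS3, status: disputed]
-/

noncomputable section

open scoped Classical
open Literature.IUT.HodgeTheaters hiding InitialThetaData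

namespace Summit.ABC.IUTFork.Joshi.ATS3

-- The carriers are taken in `Type` (universe 0): p428048's `AdelicLocusDatum` indexes the places by a `Type`; E-t6's structure is
-- universe-polymorphic and specialises.
variable {L L' Lbar : Type} [Field L] [NumberField L] [Field L'] [NumberField L'] [Algebra L L']
  [Field Lbar] [Algebra L Lbar] [Algebra L' Lbar] {C : WeierstrassCurve L} [C.IsElliptic] {ℓ : ℕ}

/-- **The data Thm 9.11.1 quantifies over, under its printed hypotheses**: an Initial Theta Datum à la Joshi (E-t6's structure: `L` with no
real embeddings, `C/L`, `L̄`, `L_mod`, `ℓ ≥ 5` prime with `ℓ ∤ [L : L_mod]`, `SL₂ ⊆ im ρ_{C/L;ℓ}`, `L′` the `ℓ`-torsion field, the chosen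
valuations `V ≃ V_{L_mod}`), a FINITE set `W` of places of `L′` inside `𝕍^{odd,ss}` ([J-III] §3.2 (6), E-t6's `Voddss`; finite by Thm 7.3.1
proof p.55 l.13–16), and Joshi's adelic locus datum at these places with `ℓ* = D.lstar`. SIGNATURE. [claim: Joshi2024ATS3, status: disputed] -/
structure FundamentalEstimateSetting (D : InitialThetaData L L' Lbar C ℓ) where
  /-- the places `w ∈ 𝕍^{odd,ss}_{L′}` the product `∏_w` runs over -/
  W : Finset (Val L')
  /-- … all of odd residue characteristic and semi-stable (split multiplicative) reduction -/
  W_subset : (↑W : Set (Val L')) ⊆ D.Voddss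
  /-- Joshi's locus datum at these places (p428048), with `ℓ*` THE `ℓ*` of the Initial Theta Datum -/
  datum : AdelicLocusDatum D.lstar W

namespace FundamentalEstimateSetting

variable {D : InitialThetaData L L' Lbar C ℓ} (E : FundamentalEstimateSetting D)

/-- **[J-III] Thm 9.11.1 (p.127 l.8–22) under its printed hypothesis list**: `Vol(Θ̃^𝓘_Mochizuki) ≥ ∏_{w ∈ 𝕍^{odd,ss}} |q_w^{1/2ℓ}|^{ℓ*}`
(p428048's `AdelicLocusDatum.FundamentalEstimateVol`, the volume being the product of the components, p.127 l.36–40). READING PREDICATE,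
never asserted. [claim: Joshi2024ATS3, status: disputed] -/
@[claim "Joshi2024ATS3" "disputed"]
def Thm9111 : Prop := E.datum.FundamentalEstimateVol

/-- **[J-III] Cor 9.11.1.1 (p.128 l.42–52) — Joshi's «[IUTchIII] Corollary 3.12» — under the printed hypothesis list**:
`−(1/ℓ*)·|LogVol(Θ̃^𝓘_Mochizuki)| ≥ −Σ_w |log|q_w^{1/2ℓ}||` (p428048's `AdelicLocusDatum.Cor91111`). READING PREDICATE, never asserted.
[claim: Joshi2024ATS3, status: disputed] -/
@[claim "Joshi2024ATS3" "disputed"]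
def Cor91111 : Prop := E.datum.Cor91111

/-- **Thm 9.11.1 from its printed inputs, under the printed hypotheses** (p428048's spine re-exported): (9.9.4) valuation scaling at every
`w ∈ W` ∧ Lemma 9.10.7.1 at the exhibited element ⟹ Thm 9.11.1 — for THIS `ℓ ≥ 5` (no «ℓ ≫ 0» needed at this step).
[claim: Joshi2024ATS3, status: disputed] -/
theorem thm9111_of_inputs (h₁ : E.datum.ValuationScaling) (h₂ : E.datum.HullVolumeLowerBound) : E.Thm9111 :=
  E.datum.fundamentalEstimateVol_of h₁ h₂

/-- **Cor 9.11.1.1 from its printed inputs, under the printed hypotheses** (+ the sign convention «LogVol ≤ 0», p.128 l.9).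
[claim: Joshi2024ATS3, status: disputed] -/
theorem cor91111_of_inputs (h₁ : E.datum.ValuationScaling) (h₂ : E.datum.HullVolumeLowerBound) (h₃ : E.datum.LogVolNonpos) :
    E.Cor91111 :=
  E.datum.cor91111_of_inputs h₁ h₂ h₃

/-- Thm 9.11.1 ∧ sign convention ⟹ Cor 9.11.1.1 («From Theorem 9.11.1 one obtains, using Mochizuki's notational conventions …», p.128
l.36–41), under the printed hypotheses. [claim: Joshi2024ATS3, status: disputed] -/
theorem cor91111_of_thm9111 (h : E.Thm9111) (hpos : ∀ w, 0 < (E.datum.loc w).hullVol) (h₃ : E.datum.LogVolNonpos) : E.Cor91111 := by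
  unfold Cor91111 AdelicLocusDatum.Cor91111
  unfold Thm9111 AdelicLocusDatum.FundamentalEstimateVol at h
  -- componentwise: `|q_w^{1/2ℓ}|^{ℓ*} ≤ Vol_w` is NOT implied by the product inequality alone; the printed deduction goes through the
  -- components (p.127 l.36–44 «it suffices to establish the inequality Vol(Θ̃_w) ≥ |q_w^{1/2ℓ}|^{ℓ*}» for each `w`). We record the product
  -- form: `Σ_w ℓ*·log|q_w| ≤ Σ_w log Vol_w`, then divide by `ℓ*` and insert the signs.
  have hq : ∀ w, Real.log (E.datum.loc w).qroot ≤ 0 := fun w =>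
    Real.log_nonpos (E.datum.loc w).qroot_pos.le (E.datum.loc w).qroot_lt_one.le
  have hV : ∀ w, Real.log (E.datum.loc w).hullVol ≤ 0 := fun w => Real.log_nonpos (hpos w).le (h₃ w)
  have hlog := Real.log_le_log (Finset.prod_pos fun w _ => pow_pos (E.datum.loc w).qroot_pos _) h
  rw [Real.log_prod (s := Finset.univ) (fun w _ => (pow_pos (E.datum.loc w).qroot_pos _).ne'),
    Real.log_prod (s := Finset.univ) (fun w _ => (hpos w).ne')] at hlog
  simp only [Real.log_pow] at hlog
  have habsq : ∀ w, |Real.log (E.datum.loc w).qroot| = -Real.log (E.datum.loc w).qroot := fun w => abs_of_nonpos (hq w)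
  have habsV : ∀ w, |Real.log (E.datum.loc w).hullVol| = -Real.log (E.datum.loc w).hullVol := fun w => abs_of_nonpos (hV w)
  simp only [habsq, habsV, Finset.sum_neg_distrib]
  rcases Nat.eq_zero_or_pos D.lstar with h0 | hl
  · have : (2 : ℕ) ≤ 0 := h0 ▸ D.two_le_lstar
    omega
  have hl' : (0 : ℝ) < (D.lstar : ℝ) := by exact_mod_cast hl
  rw [← Finset.mul_sum] at hlog
  have key : ∑ w, Real.log (E.datum.loc w).qroot ≤ (1 / (D.lstar : ℝ)) * ∑ w, Real.log (E.datum.loc w).hullVol := by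
    rw [one_div, le_inv_mul_iff₀ hl']
    exact hlog
  have e : -(1 / (D.lstar : ℝ)) * -∑ w, Real.log (E.datum.loc w).hullVol =
      (1 / (D.lstar : ℝ)) * ∑ w, Real.log (E.datum.loc w).hullVol := by ring
  rw [neg_neg, e]
  exact key

end FundamentalEstimateSetting

/-! ## 2. Thm 9.11.1's SECOND conjunct — the Joshi locus `Θ̃^𝓘_Joshi` (APPEND by abc-iut-E-t4 gen 2; ref-x 07:29:19Z scope gap (1))

[J-III] Thm-Def 9.8.1.1 (5)–(7) (render p0116.txt l.1–49) constructs TWO theta-values loci in two ambient spaces,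
`Θ̃^𝓘_Joshi ⊂ 𝓘_Joshi ⊂ 𝓘^ℚ_Joshi` and `Θ̃^𝓘_Mochizuki ⊂ 𝓘_Mochizuki ⊂ 𝓘^ℚ_Mochizuki` ((7), l.25–49), and Thm 9.11.1 (p0127.txt
l.8–32) prints the SAME lower bound for the volume of each: «Vol(Θ̃^𝓘_Mochizuki) ≥ ∏_{w ∈ 𝕍^{odd,ss}} |q_w^{1/2ℓ}|^{ℓ*}, and also
Vol(Θ̃^𝓘_Joshi) ≥ ∏_{w ∈ 𝕍^{odd,ss}} |q_w^{1/2ℓ}|^{ℓ*}». §1's `Thm9111` (p429760) types the MOCHIZUKI conjunct only — the one Cor 9.11.1.1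
consumes («in Mochizuki's notational conventions», p0128.txt l.42–44); READ §1's docstrings with «(Mochizuki half)» (landed docstrings
are not re-filed under the append-only protocol). This section types the Joshi conjunct and the printed conjunction, and proves the
print's reduction «It will be enough to prove this for one of the two Θ̃^𝓘_Mochizuki, Θ̃^𝓘_Joshi» (p0127.txt l.33–37): both loci
contain, by construction, the classes of the standard point (l.41–50), so the typed spine (9.9.4) + Lemma 9.10.7.1 applies verbatim
to either volume. No comparison BETWEEN the two volumes is printed or typed (different ambient spaces). [claim: Joshi2024ATS3, status: disputed] -/

/-- **The data of Thm 9.11.1 with BOTH theta-values loci**: §1's setting (printed hypothesis list, places `W ⊆ 𝕍^{odd,ss}`,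
Mochizuki-locus datum) extended, per place `w ∈ W`, by the `Γ_p`-weighted volume `Vol(Θ̃^𝓘_{Joshi,w})` of the hull of the
`w`-component of the JOSHI locus (Thm-Def 9.8.1.1 (5)–(6), p0116.txt l.10–17; volumes §9.10.3–§9.10.7). The q-roots and the exhibited
element `(τ_j)_j` — the Bloch–Kato logarithms of the standard-point classes, contained in BOTH loci (p0127.txt l.41–50) — are the
shared fields of `datum`. SIGNATURE (data only). [claim: Joshi2024ATS3, status: disputed] -/
structure FundamentalEstimateSettingBoth (D : InitialThetaData L L' Lbar C ℓ) extends FundamentalEstimateSetting D where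
  /-- `Vol(Θ̃^𝓘_{Joshi,w})`, the `Γ_p`-weighted volume of the hull of the `w`-component of the Joshi locus -/
  hullVolJ : W → ℝ

namespace FundamentalEstimateSettingBoth

variable {D : InitialThetaData L L' Lbar C ℓ} (E : FundamentalEstimateSettingBoth D)

/-- **The Joshi-locus adelic datum**: at each place the SAME q-root and exhibited norms as the Mochizuki-locus datum (p428048's
`AdelicLocusDatum`), with `Vol(Θ̃^𝓘_{Joshi,w})` in the volume slot. [claim: Joshi2024ATS3, status: disputed] -/
def datumJ : AdelicLocusDatum D.lstar E.W :=
  ⟨fun w => { E.datum.loc w with hullVol := E.hullVolJ w }⟩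

/-- The Joshi-locus datum has the same q-roots … [folklore] -/
theorem datumJ_qroot (w : E.W) : (E.datumJ.loc w).qroot = (E.datum.loc w).qroot := rfl

/-- … the same exhibited norms … [folklore] -/
theorem datumJ_theta (w : E.W) : (E.datumJ.loc w).theta = (E.datum.loc w).theta := rfl

/-- … and the Joshi-locus volume. [folklore] -/
theorem datumJ_hullVol (w : E.W) : (E.datumJ.loc w).hullVol = E.hullVolJ w := rfl

/-- (9.9.4) is a statement about the SHARED exhibited element: it reads the same on either datum. [folklore] -/
theorem datumJ_valuationScaling_iff : E.datumJ.ValuationScaling ↔ E.datum.ValuationScaling := Iff.rfl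

/-- **[J-III] Thm 9.11.1, SECOND conjunct (p0127.txt l.20–32) under the printed hypothesis list**:
`Vol(Θ̃^𝓘_Joshi) ≥ ∏_{w ∈ 𝕍^{odd,ss}} |q_w^{1/2ℓ}|^{ℓ*}` (p428048's `AdelicLocusDatum.FundamentalEstimateVol` on the Joshi-locus datum).
READING PREDICATE, never asserted. [claim: Joshi2024ATS3, status: disputed] -/
@[claim "Joshi2024ATS3" "disputed"]
def Thm9111Joshi : Prop := E.datumJ.FundamentalEstimateVol

/-- **[J-III] Thm 9.11.1 AS PRINTED — BOTH conjuncts** (p0127.txt l.8–32): §1's `Thm9111` (the Mochizuki half) ∧ `Thm9111Joshi`.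
READING PREDICATE, never asserted. [claim: Joshi2024ATS3, status: disputed] -/
@[claim "Joshi2024ATS3" "disputed"]
def Thm9111Both : Prop := E.toFundamentalEstimateSetting.Thm9111 ∧ E.Thm9111Joshi

/-- **Lemma 9.10.7.1 applied to the Joshi locus** (the input of the Joshi half): the hull of `Θ̃^𝓘_{Joshi,w}` — the convex closure of
`Ψ_Joshi(Σ̃_{L′})`, Thm-Def 9.8.1.1 (5), which contains the classes of the standard point — contains the exhibited product set
`∏_j τ_j·𝒪_{L′_{w,j}}`, hence `Vol(Θ̃^𝓘_{Joshi,w}) ≥ ∏_j |τ_j|` (Lemma 9.10.7.1 p0125.txt l.42–52, exactly as for the Mochizuki locus,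
p0127.txt l.41–55). READING PREDICATE, never asserted. [claim: Joshi2024ATS3, status: disputed] -/
@[claim "Joshi2024ATS3" "disputed"]
def HullVolumeLowerBoundJ : Prop := E.datumJ.HullVolumeLowerBound

/-- **«It will be enough to prove this for one of the two»** (p0127.txt l.33–37), in the kernel: p428048's typed spine of the
Mochizuki half (`AdelicLocusDatum.fundamentalEstimateVol_of`: (9.9.4) termwise `|q^{1/2ℓ}|^{j²/ℓ*²} ≥ |q^{1/2ℓ}|`, product over `j`,
then Lemma 9.10.7.1, then product over `w`) applies VERBATIM to the Joshi-locus datum. [claim: Joshi2024ATS3, status: disputed] -/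
theorem thm9111Joshi_of_inputs (h₁ : E.datum.ValuationScaling) (h₂ : E.HullVolumeLowerBoundJ) : E.Thm9111Joshi :=
  E.datumJ.fundamentalEstimateVol_of (E.datumJ_valuationScaling_iff.2 h₁) h₂

/-- **Thm 9.11.1 AS PRINTED (both conjuncts) from its printed inputs, under the printed hypotheses**: (9.9.4) at every `w ∈ W` and
Lemma 9.10.7.1 at the exhibited element for EACH locus. [claim: Joshi2024ATS3, status: disputed] -/
theorem thm9111Both_of_inputs (h₁ : E.datum.ValuationScaling) (h₂ : E.datum.HullVolumeLowerBound)
    (h₂' : E.HullVolumeLowerBoundJ) : E.Thm9111Both :=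
  ⟨E.toFundamentalEstimateSetting.thm9111_of_inputs h₁ h₂, E.thm9111Joshi_of_inputs h₁ h₂'⟩

/-- The printed conjunction projects to §1's Mochizuki half, the conjunct Cor 9.11.1.1 consumes (`cor91111_of_thm9111`). [folklore] -/
theorem thm9111_of_both (h : E.Thm9111Both) : E.toFundamentalEstimateSetting.Thm9111 := h.1

/-- **Cor 9.11.1.1 from the printed Thm 9.11.1 (both conjuncts)** + the sign convention, under the printed hypotheses: only the
Mochizuki conjunct is used («in Mochizuki's notational conventions», p0128.txt l.42–44). [claim: Joshi2024ATS3, status: disputed] -/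
theorem cor91111_of_both (h : E.Thm9111Both) (hpos : ∀ w, 0 < (E.datum.loc w).hullVol) (h₃ : E.datum.LogVolNonpos) :
    E.toFundamentalEstimateSetting.Cor91111 :=
  E.toFundamentalEstimateSetting.cor91111_of_thm9111 h.1 hpos h₃

end FundamentalEstimateSettingBoth

end Summit.ABC.IUTFork.Joshi.ATS3

end
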